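import Summits.HodgeConjecture.CorCM.TwoSheetDegenerate
import Summits.HodgeConjecture.CorCM.GaloisQuaternionCyclicPrimeNondegenerate
import Summits.HodgeConjecture.CorCM.GaloisAnnihilatorCertificates
import HarnessLib

/-!
# `Q₈ × C_p`: a SINGULAR odd two-sheet block certifies a simple DEGENERATE CM abelian `4p`-fold

COR-CM (cell `pub-hodgecm2`), binder seat b04 (gen 28), count-neutral claim QUATERNION-CYCLIC-PRIME-DEGENERATE, part I — the BAD
side of gen 25's dichotomy «`Q₈ × C_p` is GOOD iff `ord_p 2` is odd» (GOOD side: `CorCM/GaloisQuaternionCyclicPrimeNondegenerate`;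
BAD so far only by balanced-set certificates for `p = 3, 5, 11`) as a CERTIFICATE FORMAT BY CHARACTER SUMS, the twin of
`CorCM/GaloisCyclicSemidirectEightDegenerate`.  KERNEL ONLY: theorems; no definition, no named fact, no `sorry`.  `HC_CM` is
neither used nor claimed.

SETTING (gen 25, `CorCM/GaloisQuaternionCyclicPrimeTwoSheet`).  `G₀ = Q₈ × C_p = QuaternionGroup 2 × Multiplicative (ZMod p)`,
`p` an odd prime, complex conjugation `c₀ = (a 2, 1)` (the unique involution); abelian subgroup of index two
`A = ⟨a⟩ × C_p = ℤ/4 × ℤ/p`, `i(t, v) = (a t, v)`, second sheet `i(A)·x`, `x = (xa 0, 1)`, `i(t,v)·x = (xa (−t), v)`;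
`θ(t, v) = (−t, v)`, `x² = c₀ = i(2, 0)`.  For `S ⊆ G₀` with sheets `S₁ = {(t,v) | (a t, v) ∈ S}`, `S₂ = {(t,v) | (a t, v)·x ∈ S}`
and a character `χ` of `A` the two-sheet determinant is `Δ(χ) = Ŝ₁(χ)Ŝ₁(χθ) − χ(2,0)·Ŝ₂(χ)Ŝ₂(χθ)`; for odd `χ`
(`χ(2,0) = −1`) this is the sum of the two norm forms `Ŝⱼ(χ)Ŝⱼ(χθ)` («`P² + Q²`», gen 25).

* §1 **`exists_annihilator_of_singular_block`** (model): an odd `χ` with `Δ(χ) = 0` yields a NON-ZERO `c₀`-antisymmetric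
  `b : G₀ → ℚ` annihilated by every right translate of `S` (`TwoSheet.exists_annihilator_of_det_eq_zero` on gen 25's structure).
* §2 **`exists_simple_degenerate_of_singular_block`** (Galois dress): `e : Gal(K/ℚ) ≃* Q₈ × C_p`, `S` a CM set for `c₀` with
  trivial left stabiliser and a singular odd block ⟹ a PRIMITIVE DEGENERATE CM type of `K`, realised by a SIMPLE CM abelian variety of
  dimension `4p` with a rational `(q,q)` class outside the divisor ring on some power.  Part II
  (`CorCM/GaloisQuaternionCyclicPrimeNormPairs`) feeds it with `μ₄`-NORM PAIRS found by SAT (`p = 13, …`: `ord_p 2` even).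

## References

* [Kubota1965] T. Kubota, *On the field extension by complex multiplication*, Trans. AMS 118 (1965), §2, §4 Lemma 2.
* [Shimura1998] G. Shimura, *Abelian Varieties with Complex Multiplication and Modular Functions*, §6.2 Thm. 3, §8.2 Prop. 26.
* [Gordon1999HodgeAVSurvey] B. B. Gordon, *A survey of the Hodge conjecture for abelian varieties*, Thm. 6.4, §9.3, Prop. 9.4.1.
-/

noncomputable section

open CategoryTheory CategoryTheory.Limits NumberField
open scoped BigOperators

namespace Summit.HodgeConjecture.CorCM.GaloisQuaternionCyclic

open Literature.NumberTheory.ComplexMultiplication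
open Literature.AlgebraicGeometry.Motives (AbelianVariety CMType)
open Literature.AlgebraicGeometry.HodgeTheory
open Literature.AlgebraicGeometry.ComplexMultiplication (IsCMTypeRealisation)
open Literature.AlgebraicGeometry.Pohlmann1968
open Literature.Barriers.HodgeConjecture (divisorClassesSpan)
open Summit.HodgeConjecture.CorCM.GaloisRank
open Summit.HodgeConjecture.CorCM.AbelianSixteen (exists_simple_realisation_of_isPrimitive)
open QuaternionGroup AddChar

/-! ## §1 The model: a singular odd block gives a non-zero rational annihilator -/

section Model

variable {p : ℕ} [NeZero p]

/-- **A SINGULAR ODD BLOCK OF `Q₈ × C_p` GIVES A NON-ZERO RATIONAL ANNIHILATOR.**  `S ⊆ G₀` any finite set with sheets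
`S₁ = {(t,v) | (a t, v) ∈ S}`, `S₂ = {(t,v) | (a t, v)·(xa 0, 1) ∈ S}` on `A = ℤ/4 × ℤ/p`; if an odd character `χ` of `A`
(`χ(2, 0) = −1`) has `Ŝ₁(χ)Ŝ₁(χθ) − χ(2,0)·Ŝ₂(χ)Ŝ₂(χθ) = 0` (`θ(t,v) = (−t, v)`), then some non-zero `b : G₀ → ℚ` with
`b((a 2, 1)·g) = −b(g)` satisfies `Σ_{s∈S} b(s g) = 0` for every `g`. [cite: Kubota1965, §4 Lemma 2] -/
theorem exists_annihilator_of_singular_block (S : Finset (QuaternionGroup 2 × Multiplicative (ZMod p)))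
    (S₁ S₂ : Finset (Multiplicative (ZMod 4) × Multiplicative (ZMod p)))
    (hS₁ : ∀ w, w ∈ S₁ ↔ ((a (Multiplicative.toAdd w.1), w.2) : QuaternionGroup 2 × Multiplicative (ZMod p)) ∈ S)
    (hS₂ : ∀ w, w ∈ S₂ ↔
      ((a (Multiplicative.toAdd w.1), w.2) : QuaternionGroup 2 × Multiplicative (ZMod p)) * (xa 0, 1) ∈ S)
    (χ : AddChar (Additive (Multiplicative (ZMod 4) × Multiplicative (ZMod p))) ℂ)
    (hχ : χ (Additive.ofMul (Multiplicative.ofAdd (2 : ZMod 4), (1 : Multiplicative (ZMod p)))) = -1)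
    (hΔ : (∑ s ∈ S₁, χ (Additive.ofMul s)) * (∑ s ∈ S₁, χ (Additive.ofMul (s.1⁻¹, s.2))) -
      χ (Additive.ofMul (Multiplicative.ofAdd (2 : ZMod 4), (1 : Multiplicative (ZMod p)))) *
        ((∑ t ∈ S₂, χ (Additive.ofMul t)) * (∑ t ∈ S₂, χ (Additive.ofMul (t.1⁻¹, t.2)))) = 0) :
    ∃ b : QuaternionGroup 2 × Multiplicative (ZMod p) → ℚ, b ≠ 0 ∧
      (∀ g, b (((a 2, 1) : QuaternionGroup 2 × Multiplicative (ZMod p)) * g) = -b g) ∧ ∀ g, ∑ s ∈ S, b (s * g) = 0 := by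
  classical
  -- the abelian subgroup `⟨a⟩ × C_p ≅ ℤ/4 × ℤ/p`
  let i₁ : Multiplicative (ZMod 4) →* QuaternionGroup 2 :=
    MonoidHom.mk' (fun u => a (Multiplicative.toAdd u)) fun u v => by simp [toAdd_mul]
  let i : Multiplicative (ZMod 4) × Multiplicative (ZMod p) →* QuaternionGroup 2 × Multiplicative (ZMod p) :=
    MonoidHom.prodMap i₁ (MonoidHom.id _)
  have hi_apply : ∀ u v, i (u, v) = (a (Multiplicative.toAdd u), v) := fun u v => rfl
  have hi : Function.Injective i := by
    rintro ⟨u, v⟩ ⟨u', v'⟩ h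
    simp only [hi_apply, Prod.mk.injEq, a.injEq] at h
    exact Prod.ext (by simpa using h.1) h.2
  -- the second sheet `i(A) · x`, `x = (xa 0, 1)`
  have hx : ∀ w, i w ≠ (xa 0, 1) := fun ⟨u, v⟩ => by simp [hi_apply]
  have hcov : ∀ g : QuaternionGroup 2 × Multiplicative (ZMod p), (∃ w, g = i w) ∨ (∃ w, g = i w * (xa 0, 1)) := by
    rintro ⟨j | j, v⟩
    · exact Or.inl ⟨(Multiplicative.ofAdd j, v), by simp [hi_apply]⟩
    · exact Or.inr ⟨(Multiplicative.ofAdd (-j), v), by simp [hi_apply]⟩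
  -- conjugation by `x` inverts the `ℤ/4`-factor; `x² = c₀ = i(c)`, `c = (2, 0)`
  let θ : Multiplicative (ZMod 4) × Multiplicative (ZMod p) ≃* Multiplicative (ZMod 4) × Multiplicative (ZMod p) :=
    MulEquiv.prodCongr (MulEquiv.inv _) (MulEquiv.refl _)
  have hθ_apply : ∀ w, θ w = (w.1⁻¹, w.2) := fun w => rfl
  have hθ : ∀ w, ((xa 0, 1) : QuaternionGroup 2 × Multiplicative (ZMod p)) * i w = i (θ w) * (xa 0, 1) :=
    fun ⟨u, v⟩ => by simp [hi_apply, hθ_apply]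
  set c : Multiplicative (ZMod 4) × Multiplicative (ZMod p) := (Multiplicative.ofAdd 2, 1) with hc_def
  have hic : i c = (a 2, 1) := rfl
  have hxx : ((xa 0, 1) : QuaternionGroup 2 × Multiplicative (ZMod p)) * (xa 0, 1) = i c := by
    rw [hic, Prod.mk_mul_mk, xa_mul_xa, mul_one]
    norm_num
  have h22 : (2 : ZMod 4) + 2 = 0 := by decide
  have hθc : θ c = c := by
    rw [hθ_apply, hc_def]
    refine Prod.ext ?_ rfl
    change Multiplicative.ofAdd (-(2 : ZMod 4)) = Multiplicative.ofAdd 2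
    rw [neg_eq_of_add_eq_zero_left h22]
  -- the sheets in terms of `i`
  have hS₁' : ∀ w, w ∈ S₁ ↔ i w ∈ S := fun w => by rw [hS₁]; rfl
  have hS₂' : ∀ w, w ∈ S₂ ↔ i w * (xa 0, 1) ∈ S := fun w => by rw [hS₂]; rfl
  have hΔ' : (∑ s ∈ S₁, χ (Additive.ofMul s)) * (∑ s ∈ S₁, χ (Additive.ofMul (θ s))) -
      χ (Additive.ofMul c) * ((∑ t ∈ S₂, χ (Additive.ofMul t)) * (∑ t ∈ S₂, χ (Additive.ofMul (θ t)))) = 0 := by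
    simp_rw [hθ_apply]
    exact hΔ
  obtain ⟨b, hb0, hb, hbann⟩ := TwoSheet.exists_annihilator_of_det_eq_zero i hi (xa 0, 1) hx hcov θ hθ c hxx hθc S S₁ S₂
    hS₁' hS₂' χ hχ hΔ'
  exact ⟨b, hb0, fun g => by rw [← hic]; exact hb g, hbann⟩

end Model

/-! ## §2 The Galois dress: a simple DEGENERATE CM abelian `4p`-fold -/

section Field

variable {p : ℕ} [Fact p.Prime]
variable {K : Type} [Field K] [NumberField K] [IsCMField K] [IsGalois ℚ K]

/-- **SINGULAR-BLOCK CERTIFICATE ⟹ a simple DEGENERATE CM abelian `4p`-fold.**  `e : Gal(K/ℚ) ≃* Q₈ × C_p` (`p` an odd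
prime), `S ⊆ G₀` a CM set for `c₀ = (a 2, 1)` (`c₀ g ∈ S ↔ g ∉ S`) with trivial left stabiliser, sheets `S₁, S₂` on `ℤ/4 × ℤ/p`
as in §1, and an ODD character `χ` with a SINGULAR two-sheet block ⟹ `K` has a PRIMITIVE DEGENERATE CM type, realised by a SIMPLE
abelian variety of dimension `4p` with CM by `K` carrying a rational `(q,q)` class outside the divisor ring on some power.
[cite: Kubota1965, §2 and §4 Lemma 2] [cite: Shimura1998, §6.2 Thm. 3 and §8.2 Prop. 26]
[cite: Gordon1999HodgeAVSurvey, Thm. 6.4 and §9.3] -/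
theorem exists_simple_degenerate_of_singular_block (hp2 : p ≠ 2)
    (e : (K ≃ₐ[ℚ] K) ≃* QuaternionGroup 2 × Multiplicative (ZMod p))
    (S : Finset (QuaternionGroup 2 × Multiplicative (ZMod p)))
    (hScm : ∀ g, g ∈ S ↔ ((a 2, 1) : QuaternionGroup 2 × Multiplicative (ZMod p)) * g ∉ S)
    (hprim : ∀ g : QuaternionGroup 2 × Multiplicative (ZMod p), g ≠ 1 → ∃ w, ¬ (w ∈ S ↔ g * w ∈ S))
    (S₁ S₂ : Finset (Multiplicative (ZMod 4) × Multiplicative (ZMod p)))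
    (hS₁ : ∀ w, w ∈ S₁ ↔ ((a (Multiplicative.toAdd w.1), w.2) : QuaternionGroup 2 × Multiplicative (ZMod p)) ∈ S)
    (hS₂ : ∀ w, w ∈ S₂ ↔
      ((a (Multiplicative.toAdd w.1), w.2) : QuaternionGroup 2 × Multiplicative (ZMod p)) * (xa 0, 1) ∈ S)
    (χ : AddChar (Additive (Multiplicative (ZMod 4) × Multiplicative (ZMod p))) ℂ)
    (hχ : χ (Additive.ofMul (Multiplicative.ofAdd (2 : ZMod 4), (1 : Multiplicative (ZMod p)))) = -1)
    (hΔ : (∑ s ∈ S₁, χ (Additive.ofMul s)) * (∑ s ∈ S₁, χ (Additive.ofMul (s.1⁻¹, s.2))) -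
      χ (Additive.ofMul (Multiplicative.ofAdd (2 : ZMod 4), (1 : Multiplicative (ZMod p)))) *
        ((∑ t ∈ S₂, χ (Additive.ofMul t)) * (∑ t ∈ S₂, χ (Additive.ofMul (t.1⁻¹, t.2)))) = 0) :
    ∃ (Φ : CMType K) (φ₀ : K →+* ℂ) (A : AbelianVariety ℂ) (ι : 𝓞 K →+* End A)
      (θ : K →+* Module.End ℂ (complexBetti A.X 1)),
      IsPrimitive (ℂ ≃+* ℂ) Φ.1 φ₀ ∧ ¬ IsNondegenerate Φ ∧ IsCMTypeRealisation Φ A ι θ ∧ A.IsSimple ∧ A.dim = 4 * p ∧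
      ∃ n q : ℕ, ∃ x : complexBetti (⨁ fun _ : Fin n => A).X (2 * q), IsRationalClass x ∧
        IsOfHodgeType (⨁ fun _ : Fin n => A).dim (⨁ fun _ : Fin n => A).X (2 * q) q q x ∧
        x ∉ divisorClassesSpan (⨁ fun _ : Fin n => A).X (⨁ fun _ : Fin n => A).dim q := by
  classical
  have hp : p.Prime := Fact.out
  haveI : NeZero p := ⟨hp.ne_zero⟩
  have hc : e ((IsCMField.complexConj K).restrictScalars ℚ) = (a 2, 1) := map_complexConj_eq hp2 e
  obtain ⟨φ₀⟩ := (inferInstance : Nonempty (K →+* ℂ))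
  obtain ⟨Φ, hprimΦ, hread⟩ := GaloisTable.exists_isPrimitive_of_tableModel (K := K)
    (X := QuaternionGroup 2 × Multiplicative (ZMod p))
    (fun x y => x * y) e.toEquiv (fun _ _ => map_mul e _ _) (a 2, 1) hc 1 (map_one e) S hScm hprim φ₀
  have hS : ∀ y, y ∈ S ↔ embOf φ₀ (e.symm y) ∈ Φ.1 := fun y => hread y
  obtain ⟨b, hb0, hb, hbann⟩ := exists_annihilator_of_singular_block S S₁ S₂ hS₁ hS₂ χ hχ hΔ
  have hdeg : ¬ IsNondegenerate Φ := fun hnd =>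
    hb0 ((isNondegenerate_iff_forall_annihilator e hc Φ φ₀ S hS).1 hnd b hb hbann)
  obtain ⟨A, ι, θ, hA, hs, hdim⟩ := exists_simple_realisation_of_isPrimitive Φ φ₀ hprimΦ
  refine ⟨Φ, φ₀, A, ι, θ, hprimΦ, hdeg, hA, hs, ?_, exists_exceptional_pow_of_not_isNondegenerate φ₀ hprimΦ hdeg hA⟩
  rw [hdim, finrank_eq e, show 8 * p = 4 * p * 2 by ring, Nat.mul_div_cancel _ (by norm_num)]

end Field

end Summit.HodgeConjecture.CorCM.GaloisQuaternionCyclic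

end
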